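import Summits.BirchSwinnertonDyer.BirchSwinnertonDyer.Theorems.CyclotomicUntwistDescendedFrobeniusTransferBasis
import Summits.BirchSwinnertonDyer.BirchSwinnertonDyer.Theorems.CyclotomicUntwistDescendedFrobeniusPin
import HarnessLib

/-!
# Route `CyclotomicUntwist`: `IsDescendedFrobeniusMatrix ⟸ Berthelot–Ogus TRANSFER COORDINATES` — the named fact
# `isDescendedFrobeniusMatrix_exists` of `Literature.DescendedFrobeniusMatrix` reduced to the transfer statement,
# with `ClassesIndependent`, both power-map clauses, the trace and `γ ≠ 0` as THEOREMS

Cell `pub/bsd-wall` (D-0145 line `route-BirchSwinnertonDyer-CyclotomicUntwist`), prover seat `bsd-line-cycu-p2`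
(gen 6), lane «D5»; sequel of `CyclotomicUntwistDescendedFrobeniusTransferBasis` (independence of the transfer basis
`(ℓ₀, ℓ₁) = (ℓ(z⁹), ℓ(z²⁷))` in `ℚ₃(ζ₉)⟦z⟧` and its Frobenius powers). THEOREMS ONLY (no definition, no named fact,
no `sorry`); helper `--supports` K1 = stmt-BirchSwinnertonDyer-21580 (serves K2 = 21581 and the print child
C2 = stmt-BirchSwinnertonDyer-27549 `PSDescendedFrobeniusPrintedInputsAtThree`). BSD is not proved by this file and no
crux is.

* `classesIndependent_of_transfer`: transfer coordinates `(a,b,c,d)`, `ad − bc ≠ 0`, for a good model `𝓜`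
  (`𝓜.classOmega ≡ aℓ₀ + bℓ₁`, `𝓜.classEta ≡ cℓ₀ + dℓ₁` modulo `HasBoundedDenominators`) ⟹ `𝓜.ClassesIndependent`;
* `isPowerMapMatrix_of_transfer`: if moreover `!![a,c;b,d]·N = !![0,−3;1,t]·!![a,c;b,d]` then
  `𝓜.IsPowerMapMatrix 9 (N²)` and `𝓜.IsPowerMapMatrix 27 (N³)` (`z ↦ z⁹ = φ²`, `z ↦ z²⁷ = φ³` act on the transfer
  basis by `C²`, `C³`);
* **`isDescendedFrobeniusMatrix_of_transfer`**: for `t ∈ 3ℤ`, a good model, transfer coordinates for every good model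
  intertwining one `M ∈ M₂(ℚ₃)` ⟹ `W.IsDescendedFrobeniusMatrix M ∧ tr M = t ∧ M₁₀ ≠ 0` — i.e. the print child's
  `stub_descendedFrobenius` follows from «Berthelot–Ogus transfer coordinates exist» + LAW (N), the trace and the
  independence clauses of `isDescendedFrobeniusMatrix_exists` being no longer cited but proved.
[cite: BerthelotOgus1983, Thm. 2.4] [cite: Katz1981CrystallineDieudonne, §5 Thm 5.1.4 and Thm 5.3.3] [cite: Honda1970, Thm. 9]
-/

set_option autoImplicit false
-- single-conjunct summit: `Summit.BirchSwinnertonDyer.BirchSwinnertonDyer.…` repeats the name by design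
set_option linter.dupNamespace false

noncomputable section

open PowerSeries Literature.RingTheory.FormalGroups Literature.NumberTheory.EllipticCurves.DescendedFrobenius

namespace Summit.BirchSwinnertonDyer.BirchSwinnertonDyer.Theorems.DescendedFrobeniusTransfer

/-! ## §5 `IsDescendedFrobeniusMatrix ⟸ transfer coordinates` -/

section Reduction

variable {W : WeierstrassCurve ℚ}

/-- **`ClassesIndependent` from transfer coordinates.** If `classOmega ≡ aℓ₀ + bℓ₁`, `classEta ≡ cℓ₀ + dℓ₁` modulo
bounded denominators with `ad − bc ≠ 0`, the classes are independent (by §3). [cite: Katz1981CrystallineDieudonne, Thm. 5.3.3] -/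
theorem classesIndependent_of_transfer {t : ℚ_[3]} (ht : ‖t‖ ≤ ((3 : ℕ) : ℝ)⁻¹) {ℓ : ℚ_[3]⟦X⟧}
    (h1 : coeff 1 ℓ = 1) (hT : ∀ n, ‖coeff n (hondaShift 3 t ℓ)‖ ≤ 1) (𝓜 : W.NineGoodModel) {a b c d : KNine}
    (hP : a * d - b * c ≠ 0)
    (hω : HasBoundedDenominators (𝓜.classOmega - PowerSeries.C a * expand 9 (by norm_num) (ℓ.map (algebraMap ℚ_[3] KNine)) -
      PowerSeries.C b * expand 27 (by norm_num) (ℓ.map (algebraMap ℚ_[3] KNine))))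
    (hη : HasBoundedDenominators (𝓜.classEta - PowerSeries.C c * expand 9 (by norm_num) (ℓ.map (algebraMap ℚ_[3] KNine)) -
      PowerSeries.C d * expand 27 (by norm_num) (ℓ.map (algebraMap ℚ_[3] KNine)))) :
    𝓜.ClassesIndependent := by
  intro x y hxy
  set ℓ₀ := expand 9 (by norm_num) (ℓ.map (algebraMap ℚ_[3] KNine)) with hℓ₀
  set ℓ₁ := expand 27 (by norm_num) (ℓ.map (algebraMap ℚ_[3] KNine)) with hℓ₁
  have e : PowerSeries.C (x * a + y * c) * ℓ₀ + PowerSeries.C (x * b + y * d) * ℓ₁ =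
      (x • 𝓜.classOmega + y • 𝓜.classEta) -
        PowerSeries.C x * (𝓜.classOmega - PowerSeries.C a * ℓ₀ - PowerSeries.C b * ℓ₁) -
        PowerSeries.C y * (𝓜.classEta - PowerSeries.C c * ℓ₀ - PowerSeries.C d * ℓ₁) := by
    simp only [smul_eq_C_mul, map_add, map_mul]; ring
  have hbd : HasBoundedDenominators (PowerSeries.C (x * a + y * c) * ℓ₀ + PowerSeries.C (x * b + y * d) * ℓ₁) := by
    rw [e]; exact (hxy.sub (hbd_C_mul x hω)).sub (hbd_C_mul y hη)
  obtain ⟨h0, h1'⟩ := eq_zero_of_hbd_combination ht h1 hT hbd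
  constructor
  · have : x * (a * d - b * c) = 0 := by linear_combination d * h0 - c * h1'
    exact (mul_eq_zero.mp this).resolve_right hP
  · have : y * (a * d - b * c) = 0 := by linear_combination a * h1' - b * h0
    exact (mul_eq_zero.mp this).resolve_right hP

/-- **The power-map clauses from transfer coordinates.** Under the same hypotheses and for any `N ∈ M₂(ℚ₃(ζ₉))`
intertwined by the coordinate matrix, `!![a,c;b,d]·N = !![0,−3;1,t]·!![a,c;b,d]`, the matrices of `z ↦ z⁹` and
`z ↦ z²⁷` on `([ω_W],[η_W])` are `N²` and `N³` (`φ = N`, `φ² = z⁹`, `φ³ = z²⁷`).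
[cite: Katz1981CrystallineDieudonne, §5 Thm 5.1.4] [cite: BerthelotOgus1983, Thm. 2.4] -/
theorem isPowerMapMatrix_of_transfer {t : ℚ_[3]} {ℓ : ℚ_[3]⟦X⟧}
    (hT : ∀ n, ‖coeff n (hondaShift 3 t ℓ)‖ ≤ 1) (𝓜 : W.NineGoodModel) {a b c d : KNine}
    (hω : HasBoundedDenominators (𝓜.classOmega - PowerSeries.C a * expand 9 (by norm_num) (ℓ.map (algebraMap ℚ_[3] KNine)) -
      PowerSeries.C b * expand 27 (by norm_num) (ℓ.map (algebraMap ℚ_[3] KNine))))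
    (hη : HasBoundedDenominators (𝓜.classEta - PowerSeries.C c * expand 9 (by norm_num) (ℓ.map (algebraMap ℚ_[3] KNine)) -
      PowerSeries.C d * expand 27 (by norm_num) (ℓ.map (algebraMap ℚ_[3] KNine))))
    {N : Matrix (Fin 2) (Fin 2) KNine}
    (hN : !![a, c; b, d] * N = !![0, -3; 1, algebraMap ℚ_[3] KNine t] * !![a, c; b, d]) :
    𝓜.IsPowerMapMatrix 9 (by norm_num) (N ^ 2) ∧ 𝓜.IsPowerMapMatrix 27 (by norm_num) (N ^ 3) := by

  obtain ⟨F9₀, F9₁, F27₀, F27₁⟩ := hbd_frobenius_powers (ℓ := ℓ) hT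
  set L := ℓ.map (algebraMap ℚ_[3] KNine) with hL
  set tK := algebraMap ℚ_[3] KNine t with htK
  set ℓ₀ := expand 9 (by norm_num) L with hℓ₀
  set ℓ₁ := expand 27 (by norm_num) L with hℓ₁
  -- matrix identities `P N² = C² P`, `P N³ = C³ P`
  have hN2 : !![a, c; b, d] * N ^ 2 = !![0, -3; 1, tK] * !![0, -3; 1, tK] * !![a, c; b, d] := by
    rw [pow_two, ← Matrix.mul_assoc, hN, Matrix.mul_assoc, hN, ← Matrix.mul_assoc]
  have hN3 : !![a, c; b, d] * N ^ 3 = !![0, -3; 1, tK] * !![0, -3; 1, tK] * !![0, -3; 1, tK] * !![a, c; b, d] := by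
    rw [pow_succ, ← Matrix.mul_assoc, hN2, Matrix.mul_assoc, hN, ← Matrix.mul_assoc]
  set N2 := N ^ 2 with hN2def
  set N3 := N ^ 3 with hN3def
  have s : N2 0 0 * a + N2 1 0 * c = -3 * a + (-3 * tK) * b ∧
      N2 0 0 * b + N2 1 0 * d = tK * a + (tK ^ 2 - 3) * b ∧
      N2 0 1 * a + N2 1 1 * c = -3 * c + (-3 * tK) * d ∧ N2 0 1 * b + N2 1 1 * d = tK * c + (tK ^ 2 - 3) * d := by
    have h00 := congrFun (congrFun hN2 0) 0
    have h10 := congrFun (congrFun hN2 1) 0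
    have h01 := congrFun (congrFun hN2 0) 1
    have h11 := congrFun (congrFun hN2 1) 1
    simp [Matrix.mul_apply, Fin.sum_univ_two] at h00 h10 h01 h11
    refine ⟨?_, ?_, ?_, ?_⟩
    · linear_combination h00
    · linear_combination h10
    · linear_combination h01
    · linear_combination h11
  have s3 : N3 0 0 * a + N3 1 0 * c = (9 - 3 * tK ^ 2) * b + (-3 * tK) * a ∧
      N3 0 0 * b + N3 1 0 * d = (tK ^ 2 - 3) * a + (tK ^ 3 - 6 * tK) * b ∧
      N3 0 1 * a + N3 1 1 * c = (9 - 3 * tK ^ 2) * d + (-3 * tK) * c ∧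
      N3 0 1 * b + N3 1 1 * d = (tK ^ 2 - 3) * c + (tK ^ 3 - 6 * tK) * d := by
    have h00 := congrFun (congrFun hN3 0) 0
    have h10 := congrFun (congrFun hN3 1) 0
    have h01 := congrFun (congrFun hN3 0) 1
    have h11 := congrFun (congrFun hN3 1) 1
    simp [Matrix.mul_apply, Fin.sum_univ_two] at h00 h10 h01 h11
    refine ⟨?_, ?_, ?_, ?_⟩
    · linear_combination h00
    · linear_combination h10
    · linear_combination h01
    · linear_combination h11
  obtain ⟨s00, s10, s01, s11⟩ := s
  obtain ⟨u00, u10, u01, u11⟩ := s3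
  -- the generic step: a power map with known action `(p₀, p₁; r₀, r₁)` on `(ℓ₀, ℓ₁)` and matching entries
  have key : ∀ (q : ℕ) (hq : q ≠ 0) (x y p₀ p₁ r₀ r₁ : KNine) (cΓ : KNine⟦X⟧) (γ₀ γ₁ : KNine),
      HasBoundedDenominators (cΓ - PowerSeries.C γ₀ * ℓ₀ - PowerSeries.C γ₁ * ℓ₁) →
      x * a + y * c = p₀ * γ₀ + r₀ * γ₁ → x * b + y * d = p₁ * γ₀ + r₁ * γ₁ →
      HasBoundedDenominators (expand q hq ℓ₀ - (PowerSeries.C p₁ * ℓ₁ + PowerSeries.C p₀ * ℓ₀)) →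
      HasBoundedDenominators (expand q hq ℓ₁ - (PowerSeries.C r₁ * ℓ₁ + PowerSeries.C r₀ * ℓ₀)) →
      HasBoundedDenominators (expand q hq cΓ - x • 𝓜.classOmega - y • 𝓜.classEta) := by
    intro q hq x y p₀ p₁ r₀ r₁ cΓ γ₀ γ₁ hΓ e0 e1 G0 G1
    have hC0 : PowerSeries.C (x * a + y * c) = PowerSeries.C (p₀ * γ₀ + r₀ * γ₁) := by rw [e0]
    have hC1 : PowerSeries.C (x * b + y * d) = PowerSeries.C (p₁ * γ₀ + r₁ * γ₁) := by rw [e1]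
    simp only [map_add, map_mul] at hC0 hC1
    have e : expand q hq cΓ - x • 𝓜.classOmega - y • 𝓜.classEta =
        expand q hq (cΓ - PowerSeries.C γ₀ * ℓ₀ - PowerSeries.C γ₁ * ℓ₁) +
          PowerSeries.C γ₀ * (expand q hq ℓ₀ - (PowerSeries.C p₁ * ℓ₁ + PowerSeries.C p₀ * ℓ₀)) +
          PowerSeries.C γ₁ * (expand q hq ℓ₁ - (PowerSeries.C r₁ * ℓ₁ + PowerSeries.C r₀ * ℓ₀)) -
          PowerSeries.C x * (𝓜.classOmega - PowerSeries.C a * ℓ₀ - PowerSeries.C b * ℓ₁) -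
          PowerSeries.C y * (𝓜.classEta - PowerSeries.C c * ℓ₀ - PowerSeries.C d * ℓ₁) := by
      rw [map_sub, map_sub, map_mul, map_mul, expand_C, expand_C, smul_eq_C_mul, smul_eq_C_mul]
      linear_combination (-ℓ₀) * hC0 + (-ℓ₁) * hC1
    rw [e]
    exact ((((hbd_expand q hq hΓ).add (hbd_C_mul γ₀ G0)).add (hbd_C_mul γ₁ G1)).sub (hbd_C_mul x hω)).sub
      (hbd_C_mul y hη)
  refine ⟨⟨?_, ?_⟩, ⟨?_, ?_⟩⟩
  · exact key 9 _ (N2 0 0) (N2 1 0) (-3) tK (-3 * tK) (tK ^ 2 - 3) _ a b hω (by linear_combination s00)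
      (by linear_combination s10) F9₀ F9₁
  · exact key 9 _ (N2 0 1) (N2 1 1) (-3) tK (-3 * tK) (tK ^ 2 - 3) _ c d hη (by linear_combination s01)
      (by linear_combination s11) F9₀ F9₁
  · exact key 27 _ (N3 0 0) (N3 1 0) (-3 * tK) (tK ^ 2 - 3) (9 - 3 * tK ^ 2) (tK ^ 3 - 6 * tK) _ a b hω
      (by linear_combination u00) (by linear_combination u10) F27₀ F27₁
  · exact key 27 _ (N3 0 1) (N3 1 1) (-3 * tK) (tK ^ 2 - 3) (9 - 3 * tK ^ 2) (tK ^ 3 - 6 * tK) _ c d hη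
      (by linear_combination u01) (by linear_combination u11) F27₀ F27₁


/-- **THE REDUCTION.** Let `ℓ ∈ ℚ₃⟦z⟧` be a supersingular Honda logarithm of type `3 − tT + T²` (`t ∈ 3ℤ`; on a
K1/K2 row: the logarithm of the canonical lift `y² = x³ − x + b`, `t = a_w`, `…SecondKindLogClassesLift`), and
`ℓ₀ = ℓ(z⁹)`, `ℓ₁ = ℓ(z²⁷)` read in `ℚ₃(ζ₉)⟦z⟧`. If `W` has a good model over `𝓞_{ℚ₃(ζ₉)}` and for EVERY good model
`𝓜` there are TRANSFER COORDINATES `(a, b, c, d) ∈ ℚ₃(ζ₉)⁴`, `ad − bc ≠ 0`, with `𝓜.classOmega ≡ aℓ₀ + bℓ₁`,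
`𝓜.classEta ≡ cℓ₀ + dℓ₁` modulo bounded denominators and `!![a,c;b,d]·M = !![0,−3;1,t]·!![a,c;b,d]` for one rational
`M ∈ M₂(ℚ₃)`, then **`W.IsDescendedFrobeniusMatrix M`** (Literature predicate: `det M = 3`, `ClassesIndependent` and
both power-map clauses for every good model — all THEOREMS here), **`tr M = t`** and **`M₁₀ ≠ 0`**. Hence the named
fact `isDescendedFrobeniusMatrix_exists` (with its trace clause) follows from the Berthelot–Ogus transfer statement
alone. [cite: BerthelotOgus1983, Thm. 2.4] [cite: Katz1981CrystallineDieudonne, §5 Thm 5.1.4 and Thm 5.3.3] -/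
theorem isDescendedFrobeniusMatrix_of_transfer {t : ℤ} (h3t : (3 : ℤ) ∣ t) {ℓ : ℚ_[3]⟦X⟧} (h1 : coeff 1 ℓ = 1)
    (hT : ∀ n, ‖coeff n (hondaShift 3 (t : ℚ_[3]) ℓ)‖ ≤ 1) (W : WeierstrassCurve ℚ)
    (M : Matrix (Fin 2) (Fin 2) ℚ_[3]) (hne : Nonempty W.NineGoodModel)
    (hcoord : ∀ 𝓜 : W.NineGoodModel, ∃ a b c d : KNine, a * d - b * c ≠ 0 ∧
      HasBoundedDenominators (𝓜.classOmega - PowerSeries.C a * expand 9 (by norm_num) (ℓ.map (algebraMap ℚ_[3] KNine)) -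
        PowerSeries.C b * expand 27 (by norm_num) (ℓ.map (algebraMap ℚ_[3] KNine))) ∧
      HasBoundedDenominators (𝓜.classEta - PowerSeries.C c * expand 9 (by norm_num) (ℓ.map (algebraMap ℚ_[3] KNine)) -
        PowerSeries.C d * expand 27 (by norm_num) (ℓ.map (algebraMap ℚ_[3] KNine))) ∧
      !![a, c; b, d] * M.map (algebraMap ℚ_[3] KNine) =
        !![0, -3; 1, algebraMap ℚ_[3] KNine (t : ℚ_[3])] * !![a, c; b, d]) :
    W.IsDescendedFrobeniusMatrix M ∧ M.trace = (t : ℚ_[3]) ∧ M 1 0 ≠ 0 := by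
  have ht : ‖((t : ℤ) : ℚ_[3])‖ ≤ ((3 : ℕ) : ℝ)⁻¹ := by
    have := (Padic.norm_int_le_pow_iff_dvd t 1).mpr (by rw [pow_one]; exact_mod_cast h3t)
    simpa using this
  have hι : Function.Injective (algebraMap ℚ_[3] KNine) := (algebraMap ℚ_[3] KNine).injective
  -- trace and determinant from any one good model
  obtain ⟨𝓜₀⟩ := hne
  obtain ⟨a, b, c, d, hP, -, -, hN⟩ := hcoord 𝓜₀
  have hdetP : (!![a, c; b, d] : Matrix (Fin 2) (Fin 2) KNine).det ≠ 0 := by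
    rw [Matrix.det_fin_two_of]; intro h0; exact hP (by linear_combination h0)
  obtain ⟨htrK, hdetK⟩ := DescendedFrobeniusPin.trace_det_of_pin hdetP hN
  have htr : M.trace = (t : ℚ_[3]) := by
    apply hι
    rw [← htrK, Matrix.trace_fin_two, Matrix.trace_fin_two, Matrix.map_apply, Matrix.map_apply, map_add]
  have hdet : M.det = 3 := by
    apply hι
    rw [map_ofNat, ← hdetK, Matrix.det_fin_two, Matrix.det_fin_two]
    simp only [Matrix.map_apply, map_sub, map_mul]
  refine ⟨⟨hdet, ⟨𝓜₀⟩, fun 𝓜 ↦ ?_⟩, htr, ?_⟩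
  · obtain ⟨a', b', c', d', hP', hω', hη', hN'⟩ := hcoord 𝓜
    refine ⟨classesIndependent_of_transfer ht h1 hT 𝓜 hP' hω' hη', ?_, ?_⟩
    · rw [Matrix.map_pow]; exact (isPowerMapMatrix_of_transfer hT 𝓜 hω' hη' hN').1
    · rw [Matrix.map_pow]; exact (isPowerMapMatrix_of_transfer hT 𝓜 hω' hη' hN').2
  · -- `γ = 0` would make `M₀₀ ∈ ℚ₃` a root of `X² − tX + 3` (Eisenstein)
    intro h10
    rw [Matrix.det_fin_two, h10, mul_zero, sub_zero] at hdet
    rw [Matrix.trace_fin_two] at htr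
    refine DescendedFrobeniusCharpoly.padic_no_root_of_dvd (p := 3) h3t (M 0 0) ?_
    push_cast
    linear_combination (M 0 0) * htr - hdet

end Reduction

end Summit.BirchSwinnertonDyer.BirchSwinnertonDyer.Theorems.DescendedFrobeniusTransfer
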